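import Summits.NavierStokesRegularity.FluidComputer.PalasekTowerSterileCarrierAt
import Summits.NavierStokesRegularity.FluidComputer.PalasekTowerGermHostMechanismDoorAt

/-!
# THE STERILE MECHANISM DOOR AT ARBITRARY RATES `R`: an axisymmetric swirl-free amplifier meeting the door box of `R`,
# superposed ALONG THE AXIS on the sterile tame carrier, is a STERILE strict-slot profile at `R` whose free run meets the
# letter of `R` (layer L4c of the door port walked inside the swirl-free stratum — stub D2 `SterileMechanismDoorT`, Theses-free)

Cell `ns-blowup`, seat `ns-blowup-fc-prover-2` (g11; D-0074 GROUP C «BRIDGE SUPPORT»). Route `PalasekTowerBreakdown` (rev 19):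
crux stmt-NavierStokesRegularity-20303 `EpisodeBaseT`, heredity pair 20304 / 20305; stub D2 `SterileMechanismDoorT` of the
strategist's line `Cruxes/EpisodeBaseT/Lines/doormirror.lean` (cstrat-19179 g3). LABEL: E–C typing + kernel analysis (KERNEL:
theorems only; no definition, no named fact, no `sorry`, no `Theses` import). WHAT THIS IS NOT: not Navier–Stokes evidence — no
amplifier meeting the door box of any register is exhibited; the theorems say what ONE free run of a STERILE amplifier would
give; nothing registers, nothing about `RungG 1` or blow-up.

## The result

The door of record (`Germ.mechanismDoorAt_of_boxNumerics`, ecbridge-3 g9) superposes a far translate `W(· − c)` of the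
amplifier on the TAME CARRIER `tameCarrierAt R a λ`, whose `faintPusher` is an axisymmetric field of pure swirl — so even for a
sterile `W` the registering profile has swirl (refuters' `hasNoSwirl_tameCarrierAt_iff`, ecbridge-3 STATUS l.10301 (1)). Here
the carrier is the STERILE tame carrier `sterileCarrierAt R a μ` (`PalasekTowerSterileCarrierAt`: blob + coaxial poloidal ring
pusher, strict anchor by `exists_ringPusher_anchor_integral_pos`) and the translation is ALONG THE AXIS, `c = r • e₃`
(`LevelZeroDataAt.exists_superposed_freeRun` allows every `‖c‖ ≥ r₀`), which keeps the composite axisymmetric swirl-free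
(`isAxisymmetric_translate_axis`, `hasNoSwirl_translate_axis`):

* **`exists_sterile_levelZeroDataAt_freeRun_of_sterile_amplifier`** — at a register-admissible `R` (`hR : R.BoxNumerics c₃ r`):
  for every AXISYMMETRIC SWIRL-FREE smooth divergence-free `W` with `tsupport W ⊆ B̄(0, ρ)` (`ρ ≥ 0`), speed `< Y₀(R)`, and every
  classical finite-energy free run on `[1, τfirstAt R]` from `W` under `(5/3)Y₁(R) − η` showing the three level-`1` faces of
  `R` with margin `η > 0` inside `‖x‖ ≤ ρ`, there is an AXISYMMETRIC SWIRL-FREE strict-slot profile `U` at `R`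
  (`LevelZeroDataAt R U ρ'`) with a classical finite-energy free run on `[1, τfirstAt R]` from `U` under `(5/3)Y₁(R) − η/2`
  showing the three faces with margin `η/2` inside `‖x‖ ≤ ρ'`.

Composed with ecbridge-3's companion-free germ line (`Theorems.palasekTowerBreakdown_noSwirlRungGAt_one_of_sterile_freeRun`,
p558004) this is `NoSwirlRungGAt R 1` — the by-name statements live in
`Theorems/PalasekTowerBreakdownEpisodeBaseTSterileMechanismDoor.lean` (this file stays `Theses`-free).

References: S. Palasek, arXiv:2605.13827 §3.3–§4 [cite: Palasek2026ElementaryModel, §4]; T. Kato, Math. Z. 187 (1984) Thm. 2–4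
[cite: Kato1984, Thm. 2–4]; T. Tao, Anal. PDE 6 (2013) Thm. 5.4 [cite: Tao2011, Thm. 5.4 (ii)+(iv)]; A. J. Majda,
A. L. Bertozzi (CUP 2002) §2.3.3 [cite: MajdaBertozziCUP2002, §1.8 Prop. 1.16].
-/

noncomputable section

namespace Summit.NavierStokesRegularity.FluidComputer.PalasekTowerClayBridge.Germ

open Set Function Filter Topology InnerProductSpace Metric MeasureTheory
open scoped Topology ContDiff RealInnerProductSpace ENNReal NNReal
open Literature.Analysis Literature.Analysis.FluidPDE TinyBlob
open Summit.NavierStokesRegularity.EpisodeBaseTTameCarrierOfRecordHasSwirl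

variable {R : TowerRates}

/-! ## §1 Translation along the axis preserves sterility -/

/-- Rotations about the axis fix the axial vectors `r • e₃`. [folklore] -/
theorem rotZ_smul_e₃ (θ r : ℝ) : rotZ θ (r • e₃) = r • e₃ := by
  ext i
  fin_cases i <;> simp [e₃]

/-- `R_θ (x − r e₃) = R_θ x − r e₃`. [folklore] -/
theorem rotZ_sub_smul_e₃ (θ r : ℝ) (x : EuclideanSpace ℝ (Fin 3)) : rotZ θ (x - r • e₃) = rotZ θ x - r • e₃ := by
  rw [← rotZL_apply, map_sub, rotZL_apply, rotZL_apply, rotZ_smul_e₃]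

/-- **An axisymmetric field translated ALONG THE AXIS is axisymmetric.** [cite: MajdaBertozziCUP2002, §1.8 Prop. 1.16] -/
theorem isAxisymmetric_translate_axis {W : EuclideanSpace ℝ (Fin 3) → EuclideanSpace ℝ (Fin 3)} (hW : IsAxisymmetric W)
    (r : ℝ) : IsAxisymmetric fun x => W (x - r • e₃) := fun θ x => by
  show W (rotZ θ x - r • e₃) = rotZ θ (W (x - r • e₃))
  rw [← rotZ_sub_smul_e₃, hW θ]

/-- **A swirl-free field translated along the axis is swirl free** (`x₀, x₁` are unchanged). [folklore] -/
theorem hasNoSwirl_translate_axis {W : EuclideanSpace ℝ (Fin 3) → EuclideanSpace ℝ (Fin 3)} (hW : HasNoSwirl W) (r : ℝ) :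
    HasNoSwirl fun x => W (x - r • e₃) := fun x => by
  have h := hW (x - r • e₃)
  simp only [swirl, PiLp.sub_apply, PiLp.smul_apply, smul_eq_mul, e₃, PiLp.single_apply] at h ⊢
  simpa using h

/-- The sum of two axisymmetric swirl-free fields is axisymmetric swirl free. [folklore] -/
theorem sterile_add {U V : EuclideanSpace ℝ (Fin 3) → EuclideanSpace ℝ (Fin 3)} (hU : IsAxisymmetric U) (hU' : HasNoSwirl U)
    (hV : IsAxisymmetric V) (hV' : HasNoSwirl V) : IsAxisymmetric (U + V) ∧ HasNoSwirl (U + V) := by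
  refine ⟨fun θ x => ?_, fun x => ?_⟩
  · rw [Pi.add_apply, Pi.add_apply, hU θ x, hV θ x, ← rotZL_apply, ← rotZL_apply, ← rotZL_apply, map_add]
  · rw [swirl_add, hU' x, hV' x, add_zero]

/-! ## §2 The sterile superposition door at `R` -/

/-- **THE STERILE MECHANISM DOOR AT EVERY REGISTER-ADMISSIBLE `R` (Theses-free form).** `hR : R.BoxNumerics c₃ r`; `W`
AXISYMMETRIC SWIRL-FREE, smooth, divergence free, `tsupport W ⊆ B̄(0, ρ)` (`ρ ≥ 0`), speed `< Y₀(R)`; `(v, q)` a classical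
finite-energy FREE run (`ν = 1`) on `[1, τfirstAt R]` from `v 1 = W` under `(5/3) Y₁(R) − η` (`η > 0`) showing at `τfirstAt R`,
inside `‖x‖ ≤ ρ`, the speed `Y₁(R) + η`, the gradient `A₁(R) + η` and an `N₁(R)`-core loop of circulation `≥ N₁(R)^{β−2} + η`
⟹ some AXISYMMETRIC SWIRL-FREE strict-slot profile `U` at `R` (`LevelZeroDataAt R U ρ'`) has a classical finite-energy free
run on `[1, τfirstAt R]` under `(5/3) Y₁(R) − η/2` showing the three faces with margin `η/2` inside `‖x‖ ≤ ρ'`. Proof: the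
sterile tame carrier at `R` under the cap (`exists_sterile_levelZeroDataAt_tame_freeRun_cap`, band `2Y₀(R) ≤ Y₁(R)` from
`hR.sep 0`, `η ≤ Y₁(R)/3` from `margin_le_third_at`), the superposition door at `R` with the translation `c = r' • e₃` on the
axis, and §1. [cite: Palasek2026ElementaryModel, §4] [cite: Kato1984, Thm. 2–4] [cite: Tao2011, Thm. 5.4 (ii)+(iv)] -/
theorem exists_sterile_levelZeroDataAt_freeRun_of_sterile_amplifier {c₃ r : ℝ} (hR : R.BoxNumerics c₃ r)
    {W : EuclideanSpace ℝ (Fin 3) → EuclideanSpace ℝ (Fin 3)} {ρ : ℝ} (hax : IsAxisymmetric W) (hsw : HasNoSwirl W)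
    (hW : ContDiff ℝ ∞ W) (hdivW : VectorCalculus.IsDivFree W) (hWsupp : tsupport W ⊆ closedBall 0 ρ)
    (hWlt : ∀ x, ‖W x‖ < R.Y 0) (hρ : 0 ≤ ρ)
    {v : ℝ → EuclideanSpace ℝ (Fin 3) → EuclideanSpace ℝ (Fin 3)} {q : ℝ → EuclideanSpace ℝ (Fin 3) → ℝ}
    (hv : IsClassicalNSSolutionOn (Icc 1 (Host.τfirstAt R)) 1 0 v q) (hv1 : v 1 = W)
    (hvE : ∃ C : ℝ≥0∞, C < ⊤ ∧ ∀ t ∈ Icc (1 : ℝ) (Host.τfirstAt R), ∫⁻ x, ‖v t x‖ₑ ^ 2 ≤ C)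
    {η : ℝ} (hη : 0 < η)
    (hcap : ∀ t ∈ Icc (1 : ℝ) (Host.τfirstAt R), ∀ x, ‖v t x‖ ≤ 5 / 3 * R.Y 1 - η)
    (hspeed : ∃ x, ‖x‖ ≤ ρ ∧ R.Y 1 + η ≤ ‖v (Host.τfirstAt R) x‖)
    (hstrain : ∃ x, ‖x‖ ≤ ρ ∧ R.A 1 + η ≤ ‖fderiv ℝ (v (Host.τfirstAt R)) x‖)
    (hcore : ∃ (x : EuclideanSpace ℝ (Fin 3)) (γ : ℝ → EuclideanSpace ℝ (Fin 3)),
      ‖x‖ ≤ ρ ∧ ContDiff ℝ 1 γ ∧ γ 0 = γ 1 ∧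
      (∀ s ∈ Icc (0 : ℝ) 1, γ s ∈ closedBall x (1 / R.N 1)) ∧
      (∀ s ∈ Icc (0 : ℝ) 1, ‖deriv γ s‖ ≤ 8 * Real.pi / R.N 1) ∧
      R.N 1 ^ (R.β - 2) + η ≤ circulation (v (Host.τfirstAt R)) γ) :
    ∃ (U : EuclideanSpace ℝ (Fin 3) → EuclideanSpace ℝ (Fin 3)) (ρ' : ℝ),
      LevelZeroDataAt R U ρ' ∧ IsAxisymmetric U ∧ HasNoSwirl U ∧
      ∃ (u : ℝ → EuclideanSpace ℝ (Fin 3) → EuclideanSpace ℝ (Fin 3)) (p : ℝ → EuclideanSpace ℝ (Fin 3) → ℝ),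
        IsClassicalNSSolutionOn (Icc 1 (Host.τfirstAt R)) 1 0 u p ∧ u 1 = U ∧
        (∃ C : ℝ≥0∞, C < ⊤ ∧ ∀ t ∈ Icc (1 : ℝ) (Host.τfirstAt R), ∫⁻ x, ‖u t x‖ₑ ^ 2 ≤ C) ∧
        0 < η / 2 ∧
        (∀ t ∈ Icc (1 : ℝ) (Host.τfirstAt R), ∀ x, ‖u t x‖ ≤ 5 / 3 * R.Y 1 - η / 2) ∧
        (∃ x, ‖x‖ ≤ ρ' ∧ R.Y 1 + η / 2 ≤ ‖u (Host.τfirstAt R) x‖) ∧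
        (∃ x, ‖x‖ ≤ ρ' ∧ R.A 1 + η / 2 ≤ ‖fderiv ℝ (u (Host.τfirstAt R)) x‖) ∧
        (∃ (x : EuclideanSpace ℝ (Fin 3)) (γ : ℝ → EuclideanSpace ℝ (Fin 3)),
          ‖x‖ ≤ ρ' ∧ ContDiff ℝ 1 γ ∧ γ 0 = γ 1 ∧
          (∀ s ∈ Icc (0 : ℝ) 1, γ s ∈ closedBall x (1 / R.N 1)) ∧
          (∀ s ∈ Icc (0 : ℝ) 1, ‖deriv γ s‖ ≤ 8 * Real.pi / R.N 1) ∧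
          R.N 1 ^ (R.β - 2) + η / 2 ≤ circulation (u (Host.τfirstAt R)) γ) := by
  have hτ : Host.τfirstAt R ∈ Icc (1 : ℝ) (Host.τfirstAt R) := ⟨(Host.one_lt_τfirstAt R).le, le_rfl⟩
  have hη3 : η ≤ R.Y 1 / 3 := margin_le_third_at hspeed (hcap (Host.τfirstAt R) hτ)
  -- the sterile tame carrier at `R` under the cap
  obtain ⟨U₁, hLZ, hax₁, hsw₁, v₁, q₁, hv₁, hv₁1, hE₁, hcap₁⟩ :=
    exists_sterile_levelZeroDataAt_tame_freeRun_cap (hR.sep 0) hη3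
  -- the superposition door at `R`
  obtain ⟨r₀, hr₀⟩ := hLZ.exists_superposed_freeRun hW hdivW hWsupp hWlt hρ hv₁ hv₁1 hE₁ hv hv1 hvE hη hcap₁ hcap
    hspeed hstrain hcore
  -- a translation vector of length `≥ r₀` ON THE AXIS
  set c : EuclideanSpace ℝ (Fin 3) := (max r₀ 0) • e₃ with hc_def
  have hc : r₀ ≤ ‖c‖ := by
    rw [hc_def, norm_smul, norm_e₃, mul_one, Real.norm_eq_abs, abs_of_nonneg (le_max_right _ _)]
    exact le_max_left _ _
  obtain ⟨hLZ', u, p, hu, hu1, huE, hucap, husp, hust, huco⟩ := hr₀ c hc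
  -- sterility of the composite
  obtain ⟨haxU, hswU⟩ := sterile_add hax₁ hsw₁ (isAxisymmetric_translate_axis hax (max r₀ 0))
    (hasNoSwirl_translate_axis hsw (max r₀ 0))
  exact ⟨_, _, hLZ', haxU, hswU, u, p, hu, hu1, huE, half_pos hη, hucap, husp, hust, huco⟩

end Summit.NavierStokesRegularity.FluidComputer.PalasekTowerClayBridge.Germ

end
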